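import Mathlib
import HarnessLib
import Summits.Langlands.Langlands.Theses.OccultE6Transport
import Literature.NumberTheory.GaloisRepresentations.AdequateSubgroup

/-!
# Birth skeleton (BC3) for crux stmt-Langlands-14223
`Summit.Langlands.Langlands.Theses.OccultE6Transport.PolarisedLiftingRank5` — line `birth`

Route `route-Langlands-OccultE6Transport` (`closes : E6ResidualTransport → PolarisedLiftingRank5 →
SectorComplement → Langlands`).  The crux (rank 3, "μ-ORDINARY IRREGULAR LIFTING IN RANK 5 OVER
K = ℚ(ω)") says: a rank-5 weakly compatible system `𝓢` over `K = CyclotomicField 3 ℚ` with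
coefficients `E` which at some `λ ∣ 3` (i) reduces a.e. to an `SO₅(𝔽₃)`-valued `ρ̄_K` whose image
contains every commutator of `SO₅(𝔽₃)` and which is residually automorphic of regular weight, (ii) is
absolutely irreducible, (iii) has μ-ordinary occult shape at the prime over 3, and (iv) is polarised,
is automorphic: for EVERY embedding `emb : E →+* ℂ` and every `hcpt` there is an L-algebraic cuspidal
`π` on `GL₅(𝔸_K)` whose Satake polynomials are `emb (𝓢.charpoly v)` at almost all `v`.

This file is the skeleton that concludes the crux BY NAME from three named stubs, cut along the three
mathematically independent inputs of any automorphy-lifting proof of it (residual image ⟶ λ-adic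
lifting for one complex embedding ⟶ independence of the embedding):

* `stub_commutatorImageAdequate` — BIG RESIDUAL IMAGE FROM THE E₆ TYPE (finite group theory at
  `p = 3`; the "adequacy of Ω₅(𝔽₃) ⊂ GL₅(𝔽̄₃) at p = 3" that the crux docstring names as an open check
  inside this node): an `SO₅(𝔽₃)`-valued `ρ̄_K` whose image contains `[SO₅(𝔽₃), SO₅(𝔽₃)] = Ω₅(𝔽₃)`
  (so the image is `Ω₅(𝔽₃) ≅ PSp₄(𝔽₃)` of order 25920 or `SO₅(𝔽₃) ≅ W(E₆)` of order 51840) is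
  absolutely irreducible and its image in `GL₅(𝔽̄₃)` is adequate in Thorne's sense
  (`Subgroup.IsThorneAdequate`, Thorne 2012 Def. 2.3 with the GHTT semisimple clause).  `3 ∤ 5`, the
  groups are perfect resp. have abelianisation `ℤ/2`, and `Ω₅(𝔽₃)` is absolutely irreducible on `𝔽₃⁵`,
  so clauses (i), (ii) hold; the content is `H¹(Ω₅(𝔽₃), ad⁰) = 0` with `ad⁰ = ∧²V ⊕ Sym²₀V` (10 + 14)
  in the defining characteristic `p = 3 < 2(n+1)` (outside GHTT Thm. 9) and the spanning clause (iv).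
  Killable by one GAP/Magma computation (cheapest falsifier of the line); size M.
* `stub_ordinaryLiftingOneEmbedding` — THE ENGINE (λ-adic μ-ordinary irregular-weight automorphy
  lifting in rank 5 over `K`, ONE coefficient embedding out): under the crux hypotheses at `λ`, with
  the commutator/orthogonality clauses replaced by what a lifting theorem consumes — `ρ̄_K` absolutely
  irreducible with adequate image over `𝔽̄₃` — there is SOME embedding `emb₀ : E →+* ℂ` under which
  `𝓢` is automorphic (L-algebraic cuspidal `π`, Satake polynomials `emb₀ (𝓢.charpoly v)` a.e.).  This
  is the honest shadow of "`ρ_λ ≅ r_ι(π)` for an `ι : Ē_λ ≅ ℂ`".  Intended proof (route header):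
  μ-ordinary higher Hida theory for `GU(4,1)/ℚ` on the Allcock–Carlson–Toledo ball quotient at the
  ramified prime 3, irregular-weight `R^{ord} = 𝕋` on patched ordinary coherent complexes
  (Calegari–Geraghty / BCGP template), Sen = Cousin classicality of the singular-weight limit.  Size:
  open-problem (the hardest stub; it carries every engine risk named in the crux's why-it-might-fail
  EXCEPT the two peeled off into stubs 1 and 3).
* `stub_embeddingChange` — INDEPENDENCE OF THE COMPLEX EMBEDDING (`Aut(ℂ)`-stability of L-algebraic
  cuspidal Satake systems on `GL₅/ℚ(ω)`): if a system of polynomials `P v ∈ E[X]` over a number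
  field `E` is realised, through `emb₀ : E →+* ℂ`, as the Satake polynomials `∏ (X - a⁻¹)` of an
  L-algebraic cuspidal `π` on `GL₅(𝔸_K)` at almost all `v`, then it is so realised through every
  `emb : E →+* ℂ`.  Extend `emb ∘ emb₀⁻¹` to `σ ∈ Aut(ℂ)`; for `n = 5` odd, L-algebraic = C-algebraic
  and the unramified Hecke eigenvalues are `q_v^{i(5-i)/2} e_i(α)` with INTEGER exponents, so the claim
  is exactly the existence of the `σ`-conjugate `^σπ` (tree: `IsAutConjugate σ π.1 π'.1`) — Clozel 1990
  Thm. 3.13 (tree fact `Clozel1990_regularAlgebraic`) when `π` is regular, Clozel's / Buzzard–Gee's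
  algebraicity conjecture in the irregular weight this route needs (for the coherent-cohomological
  `π` on `U(4,1)` at hand: rationality of coherent cohomology of the Picard ball quotient à la
  Harris / Blasius–Harris–Ramakrishnan, then Mok/KMSW transfer).  This is the crux's listed risk
  "one λ in → all emb out", made a named lemma.  Size L.

Shape (for `ledger skeleton check` / `#h21_check_skeleton`): §0 names the crux's clauses as `def`s
(VERBATIM copies under the route file's `open`s; `crux_iff` is `Iff.rfl`, which certifies it); each
stub is `theorem stub_<name> (binders) : <conclusion> := by sorry`; `_Goal.stub_<name> : Prop :=
type_of% @stub_<name>` names that statement; the composition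
`PolarisedLiftingRank5_of (h₁ : _Goal.stub_commutatorImageAdequate)
(h₂ : _Goal.stub_ordinaryLiftingOneEmbedding) (h₃ : _Goal.stub_embeddingChange) :
PolarisedLiftingRank5` is proved without `sorry` and concludes the route decl BY NAME; the last
`example` feeds the three stubs to it.

Disproof used: none — `ledger crux ls stmt-Langlands-14223` shows no `Disproof.lean` and the negatives
index of the summit has no entry on this crux (2026-08-17).  BC3 probes (planner folder
`bc/probe_*.lean`): for each stub, `stub → PolarisedLiftingRank5` and `stub → Langlands` by
`first | exact? | simpa | aesop` FAIL (recorded in NOTES.md with rc and the unsolved goals).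
-/

set_option linter.dupNamespace false

noncomputable section

namespace Summit.Langlands.Langlands.Cruxes.PolarisedLiftingRank5.Birth

open Summit.Langlands.Langlands.Theses.OccultE6Transport
open scoped BigOperators Topology Manifold Classical MeasureTheory ProbabilityTheory Matrix InnerProductSpace ComplexConjugate ContinuousMap
open Filter Set Function TopologicalSpace MeasureTheory
open Literature.NumberTheory.GaloisRepresentations Literature.NumberTheory.Automorphic Polynomial NumberField IsDedekindDomain Field

/-! ## 0. Named copies of the crux's clauses (verbatim; `crux_iff` below is `Iff.rfl`) -/

/-- Clause (i-a) of the crux: `ρ̄_K` takes values in `SO₅(𝔽₃)` (standard form `gᵀ g = 1`, `det g = 1`). [folklore] -/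
def IsOrthogonalDetOne (ρK : FramedGaloisRep (CyclotomicField 3 ℚ) (ZMod 3) 5) : Prop :=
  ∀ σ, (ρK σ).valᵀ * (ρK σ).val = 1 ∧ (ρK σ).val.det = 1

/-- Clause (i-b) of the crux: the image of `ρ̄_K` contains every commutator of `SO₅(𝔽₃)`, i.e.
`⊇ Ω₅(𝔽₃) = [SO₅(𝔽₃), SO₅(𝔽₃)] ≅ PSp₄(𝔽₃) ≅ W(E₆)′`. [folklore] -/
def ContainsCommutators (ρK : FramedGaloisRep (CyclotomicField 3 ℚ) (ZMod 3) 5) : Prop :=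
  ∀ g h : Matrix (Fin 5) (Fin 5) (ZMod 3), gᵀ * g = 1 → g.det = 1 → hᵀ * h = 1 → h.det = 1 →
    ∃ σ, (ρK σ).val = g * h * g⁻¹ * h⁻¹

/-- Clause (i-c) of the crux (verbatim the conclusion of `E6ResidualTransport` at `ρ̄_K`): `ρ̄_K` is
RESIDUALLY AUTOMORPHIC OF REGULAR WEIGHT over `K` — for every `hcpt` a regular algebraic cuspidal `π`
on `GL₅(𝔸_K)`, a subring `𝒪 ⊂ ℂ` holding its `q²`-normalised Hecke polynomials a.e. and `θ : 𝒪 → k ⊇ 𝔽₃`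
reducing them to the characteristic polynomials of `ρ̄_K` at geometric Frobenius. [folklore] -/
def ResiduallyAutomorphicRegular (ρK : FramedGaloisRep (CyclotomicField 3 ℚ) (ZMod 3) 5) : Prop :=
  ∀ hcpt : isCompact_glFiniteIntegralLevel 5 (CyclotomicField 3 ℚ), ∃ (π : CuspidalAutomorphicRepData 5 (CyclotomicField 3 ℚ) hcpt) (k : Type) (_ : Field k) (j : ZMod 3 →+* k) (𝒪 : Subring ℂ) (θ : 𝒪 →+* k), π.1.IsRegularAlgebraic ∧ ∀ᶠ v : HeightOneSpectrum (𝓞 (CyclotomicField 3 ℚ)) in cofinite, ∃ (α : Multiset ℂ) (P₀ : Polynomial 𝒪), π.1.HasSatakeParamAt v α ∧ P₀.map 𝒪.subtype = (α.map fun a ↦ X - C ((v.residueCard : ℂ) ^ 2 * a)).prod ∧ ∀ 𝔓 ∈ v.primesAbove, ∀ σ : absoluteGaloisGroup (CyclotomicField 3 ℚ), IsArithFrobAt (𝓞 (CyclotomicField 3 ℚ)) σ 𝔓 → (ρK σ)⁻¹.val.charpoly.map j = P₀.map θ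

/-- Clause (iii) of the crux: μ-ORDINARY OCCULT SHAPE of `𝓢.rep λ` at the prime `𝔓` over 3 — a ring
map `φ : ℤ₃ → E_λ`, an integer `a`, a frame `Q` and an open `U ≤ Γ_K` with `Q⁻¹ ρ(σ) Q` block upper
triangular of type (1,3,1) on the stabiliser of `𝔓`, and on inertia ∩ `U`: entry (0,0) `= φ(ε(σ))^a`,
entry (4,4) `= φ(ε(σ))^(a-1)`, middle 3×3 block scalar. [folklore] -/
def MuOrdinaryOccultShape (E : Type) [Field E] [NumberField E]
    (𝓢 : CompatibleSystem (CyclotomicField 3 ℚ) E 5) («λ» : HeightOneSpectrum (𝓞 E)) : Prop :=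
  ∀ v : HeightOneSpectrum (𝓞 (CyclotomicField 3 ℚ)), (3 : 𝓞 (CyclotomicField 3 ℚ)) ∈ v.asIdeal → ∀ 𝔓 ∈ v.primesAbove, ∃ (φ : PadicInt 3 →+* «λ».adicCompletion E) (a : ℤ) (Q : GL (Fin 5) («λ».adicCompletion E)) (U : Subgroup (absoluteGaloisGroup (CyclotomicField 3 ℚ))), IsOpen (U : Set (absoluteGaloisGroup (CyclotomicField 3 ℚ))) ∧ (∀ σ : absoluteGaloisGroup (CyclotomicField 3 ℚ), (∀ x ∈ 𝔓, σ • x ∈ 𝔓) → (Q⁻¹ * 𝓢.rep «λ» σ * Q).val.BlockTriangular ![0, 1, 1, 1, 2]) ∧ ∀ σ ∈ 𝔓.inertia (absoluteGaloisGroup (CyclotomicField 3 ℚ)), σ ∈ U → (Q⁻¹ * 𝓢.rep «λ» σ * Q).val 0 0 = φ (GaloisRep.cyclotomicCharacter (CyclotomicField 3 ℚ) 3 σ).val ^ a ∧ (Q⁻¹ * 𝓢.rep «λ» σ * Q).val 4 4 = φ (GaloisRep.cyclotomicCharacter (CyclotomicField 3 ℚ) 3 σ).val ^ (a - 1) ∧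 ∃ c : «λ».adicCompletion E, ∀ i j : Fin 5, i ≠ 0 → i ≠ 4 → j ≠ 0 → j ≠ 4 → (Q⁻¹ * 𝓢.rep «λ» σ * Q).val i j = if i = j then c else 0

/-- The reduction clause of the crux: at almost every `v` the common Frobenius polynomial of `𝓢` is
`λ`-integral and reduces, through `j : 𝔽₃ → 𝓞_E/λ`, to the characteristic polynomial of `ρ̄_K` at
arithmetic Frobenius. [folklore] -/
def ReducesTo (E : Type) [Field E] [NumberField E] (𝓢 : CompatibleSystem (CyclotomicField 3 ℚ) E 5)
    («λ» : HeightOneSpectrum (𝓞 E)) (j : ZMod 3 →+* 𝓞 E ⧸ «λ».asIdeal)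
    (ρK : FramedGaloisRep (CyclotomicField 3 ℚ) (ZMod 3) 5) : Prop :=
  ∀ᶠ v : HeightOneSpectrum (𝓞 (CyclotomicField 3 ℚ)) in cofinite, ∃ P₀ : Polynomial (𝓞 E), P₀.map (algebraMap (𝓞 E) E) = 𝓢.charpoly v ∧ ∀ 𝔓 ∈ v.primesAbove, ∀ σ : absoluteGaloisGroup (CyclotomicField 3 ℚ), IsArithFrobAt (𝓞 (CyclotomicField 3 ℚ)) σ 𝔓 → (ρK σ).val.charpoly.map j = P₀.map (Ideal.Quotient.mk «λ».asIdeal)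

/-- Clause (iv) of the crux: `𝓢` is POLARISED — at the conjugate place the Frobenius polynomial is the
`q^a`-reciprocal dual. [folklore] -/
def Polarised (E : Type) [Field E] [NumberField E] (𝓢 : CompatibleSystem (CyclotomicField 3 ℚ) E 5) :
    Prop :=
  ∃ a : ℤ, ∀ σ : (CyclotomicField 3 ℚ) ≃ₐ[ℚ] (CyclotomicField 3 ℚ), σ ≠ AlgEquiv.refl → ∀ v w : HeightOneSpectrum (𝓞 (CyclotomicField 3 ℚ)), v ∉ 𝓢.bad → w ∉ 𝓢.bad → w.asIdeal = Ideal.comap (RingOfIntegers.mapRingHom σ.toRingEquiv.toRingHom) v.asIdeal → 𝓢.charpoly w = C ((𝓢.charpoly v).coeff 0)⁻¹ * ((𝓢.charpoly v).comp (C ((v.residueCard : E) ^ a) * X)).reverse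

/-- `SatakeRealises P emb hcpt`: the system of polynomials `P v ∈ E[X]` is, through the complex
embedding `emb`, the system of Satake polynomials `∏_{a ∈ α_v} (X - a⁻¹)` of an L-algebraic cuspidal
`π` on `GL₅(𝔸_K)` at almost all finite places `v` (the crux's conclusion is
`∀ emb hcpt, SatakeRealises 𝓢.charpoly emb hcpt`). [folklore] -/
def SatakeRealises {E : Type} [Field E]
    (P : HeightOneSpectrum (𝓞 (CyclotomicField 3 ℚ)) → Polynomial E) (emb : E →+* ℂ)
    (hcpt : isCompact_glFiniteIntegralLevel 5 (CyclotomicField 3 ℚ)) : Prop :=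
  ∃ π : CuspidalAutomorphicRepData 5 (CyclotomicField 3 ℚ) hcpt, π.1.IsLAlgebraic ∧ ∀ᶠ v : HeightOneSpectrum (𝓞 (CyclotomicField 3 ℚ)) in cofinite, ∃ α : Multiset ℂ, π.1.HasSatakeParamAt v α ∧ (P v).map emb = (α.map fun a ↦ X - C a⁻¹).prod

/-- The crux, clause by clause (definitional unfolding of §0; certifies the copies are verbatim). [folklore] -/
theorem crux_iff : PolarisedLiftingRank5 ↔
    ∀ (E : Type) [Field E] [NumberField E] (𝓢 : CompatibleSystem (CyclotomicField 3 ℚ) E 5),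
      (∃ («λ» : HeightOneSpectrum (𝓞 E)) (j : ZMod 3 →+* 𝓞 E ⧸ «λ».asIdeal)
          (ρK : FramedGaloisRep (CyclotomicField 3 ℚ) (ZMod 3) 5),
        IsOrthogonalDetOne ρK ∧ ContainsCommutators ρK ∧ ResiduallyAutomorphicRegular ρK ∧
          FramedRep.IsAbsolutelyIrreducible (𝓢.rep «λ») ∧ MuOrdinaryOccultShape E 𝓢 «λ» ∧
            ReducesTo E 𝓢 «λ» j ρK) →
      Polarised E 𝓢 →
        ∀ (emb : E →+* ℂ) (hcpt : isCompact_glFiniteIntegralLevel 5 (CyclotomicField 3 ℚ)),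
          SatakeRealises 𝓢.charpoly emb hcpt :=
  Iff.rfl

/-! ## 1. The two notions the engine consumes (big residual image over `𝔽̄₃`) -/

/-- Extension of scalars `GL₅(𝔽₃) → GL₅(𝔽̄₃)` (Thorne's Def. 2.3 is read over a field containing the
eigenvalues of all elements of the image; `𝔽̄₃` is the uniform choice). [folklore] -/
def toFbar : GL (Fin 5) (ZMod 3) →* GL (Fin 5) (AlgebraicClosure (ZMod 3)) :=
  Matrix.GeneralLinearGroup.map (n := Fin 5) (algebraMap (ZMod 3) (AlgebraicClosure (ZMod 3)))

/-- `ρ̄_K` HAS ADEQUATE IMAGE OVER `𝔽̄₃`: the subgroup `ρ̄_K(Γ_K) ⊗ 𝔽̄₃ ≤ GL₅(𝔽̄₃)` is adequate in the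
sense of Thorne 2012, Def. 2.3 (tree `Subgroup.IsThorneAdequate`; note `K = ℚ(ζ₃)` so `Γ_{K(ζ₃)} = Γ_K`
and this IS Thorne's hypothesis "`ρ̄(G_{F(ζ_l)})` adequate"). [cite: Thorne2012, Def. 2.3] -/
def HasAdequateImageFbar (ρK : FramedGaloisRep (CyclotomicField 3 ℚ) (ZMod 3) 5) : Prop :=
  Subgroup.IsThorneAdequate ((ρK.toMonoidHom.range).map toFbar)

/-! ## 2. The three stubs -/

/-- **STUB 1 — big residual image from the E₆ type** (finite group theory at `p = 3`).  An
`SO₅(𝔽₃)`-valued `ρ̄_K` whose image contains every commutator of `SO₅(𝔽₃)` has image `Ω₅(𝔽₃)` (order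
25920, `≅ PSp₄(𝔽₃) ≅ W(E₆)′`, simple) or `SO₅(𝔽₃)` (order 51840, `≅ W(E₆)`); the claim is that such an
image is ABSOLUTELY IRREDUCIBLE on `𝔽₃⁵` (true: `Ω₅(𝔽₃)` is absolutely irreducible on its natural
module) and ADEQUATE in `GL₅(𝔽̄₃)`: (i) `Hom(H, 𝔽̄₃) = 0` (perfect / abelianisation `ℤ/2`, `char 3`);
(ii) `(ad⁰)^H = 0` (absolute irreducibility and `3 ∤ 5`); (iii) `H¹(H, ad⁰) = 0` with
`ad⁰ = ∧²V ⊕ Sym²₀V` (dimensions 10 + 14) — the genuine content, `p = 3` being far below the generic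
range `p ≥ 2(n+1) = 12` of GHTT Thm. 9; (iv) the semisimple elements of `H` detect every simple
constituent of `ad⁰` through `tr e_{h,α}`.  Why plausibly true: `Ω₅(3)` is a large group of Lie type in
its defining characteristic acting through small restricted modules, where `H¹` vanishes outside a
short explicit list (Cline–Parshall–Scott, Jones–Parshall; UGA VIGRE tables); why it might fail:
`q = p = 3` is exactly where the exceptional non-vanishing of `H¹` lives, and a failure of (iii) or
(iv) sends the line to Thorne's extended adequacy / a different lifting theorem.  Cheapest falsifier:
one GAP/Magma run (`H¹(PSp₄(3), M)` for the 10- and 14-dimensional modules over `𝔽₉`, `𝔽₈₁`).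
Size M.  Leans on: `Subgroup.IsThorneAdequate`, `FramedRep.IsAbsolutelyIrreducible` (tree), Mathlib
`Matrix.GeneralLinearGroup.map`, `AlgebraicClosure`. [cite: Thorne2012, Def. 2.3 and Lemma 2.4 (appendix Guralnick–Herzig–Taylor–Thorne, Lemma 1, Thm. 9)] -/
theorem stub_commutatorImageAdequate (ρK : FramedGaloisRep (CyclotomicField 3 ℚ) (ZMod 3) 5)
    (hO : IsOrthogonalDetOne ρK) (hC : ContainsCommutators ρK) :
    FramedRep.IsAbsolutelyIrreducible ρK ∧ HasAdequateImageFbar ρK := by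
  sorry

/-- **STUB 2 — the engine: λ-adic μ-ordinary irregular-weight automorphy lifting in rank 5 over
`K = ℚ(ω)`, ONE coefficient embedding out** (the hardest stub; difficulty open-problem).  For a rank-5
weakly compatible system `𝓢` over `K` with coefficients `E` and a place `λ` (necessarily `λ ∣ 3`: the
shape clause asks for a ring map `ℤ₃ → E_λ`) such that `ρ̄_K : Γ_K → GL₅(𝔽₃)` is absolutely irreducible
with ADEQUATE image over `𝔽̄₃` (stub 1's output — what a Thorne/BCGP-type lifting theorem consumes, in
place of the E₆ clauses), `ρ̄_K` is residually automorphic of regular weight, `𝓢.rep λ` is absolutely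
irreducible, has μ-ordinary occult shape at the prime over 3 and reduces to `ρ̄_K` a.e., and `𝓢` is
polarised: there is an embedding `emb₀ : E →+* ℂ` through which `𝓢` is automorphic (for every `hcpt`
an L-algebraic cuspidal `π` on `GL₅(𝔸_K)` with Satake polynomials `emb₀ (𝓢.charpoly v)` a.e.) — the
typed shadow of "`ρ_λ ≅ r_ι(π)` for some `ι : Ē_λ ≅ ℂ`".  Intended proof: μ-ordinary higher Hida
theory for `GU(4,1)/ℚ` (signature (4,1) Picard ball quotient of Allcock–Carlson–Toledo) at the
RAMIFIED prime 3; irregular-weight `R^{ord} = 𝕋` by patching perfect complexes of ordinary coherent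
cohomology in two degrees (Calegari–Geraghty; BCGP 2025 §§3–7 is the `GSp₄/ℚ`, `p` split template);
Sen = Cousin classicality and de Rhamness of the singular-weight limit; descent `U(4,1) ↔ GL₅/K`.
Why it might fail: no such engine exists at a ramified prime; the middle scalar character of the
shape clause is free (no de Rham clause on weakly compatible systems), the residual automorphy is not
asked ordinary or polarised, `p = 3 ∣ #Ω₅(𝔽₃)`.  Leans on: `CompatibleSystem`,
`CuspidalAutomorphicRepData`, `AutomorphicRepData.IsLAlgebraic`, `HasSatakeParamAt` (tree).
[cite: BCGP2025ModularityAbelianSurfaces, Thm. 1.1 and §§3–7 (arXiv:2502.20645)] [cite: BoxerEtAl2021, Thm. 1.1.3] [cite: CalegariGeraghty2017, §1] [cite: Thorne2012, Thm. 7.1] -/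
theorem stub_ordinaryLiftingOneEmbedding (E : Type) [Field E] [NumberField E]
    (𝓢 : CompatibleSystem (CyclotomicField 3 ℚ) E 5)
    (hlam : ∃ («λ» : HeightOneSpectrum (𝓞 E)) (j : ZMod 3 →+* 𝓞 E ⧸ «λ».asIdeal)
        (ρK : FramedGaloisRep (CyclotomicField 3 ℚ) (ZMod 3) 5),
      FramedRep.IsAbsolutelyIrreducible ρK ∧ HasAdequateImageFbar ρK ∧
        ResiduallyAutomorphicRegular ρK ∧ FramedRep.IsAbsolutelyIrreducible (𝓢.rep «λ») ∧
          MuOrdinaryOccultShape E 𝓢 «λ» ∧ ReducesTo E 𝓢 «λ» j ρK)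
    (hpol : Polarised E 𝓢) :
    ∃ emb₀ : E →+* ℂ, ∀ hcpt : isCompact_glFiniteIntegralLevel 5 (CyclotomicField 3 ℚ),
      SatakeRealises 𝓢.charpoly emb₀ hcpt := by
  sorry

/-- **STUB 3 — independence of the complex embedding** (`Aut(ℂ)`-stability of L-algebraic cuspidal
Satake systems on `GL₅/ℚ(ω)`).  If a system `P v ∈ E[X]` (`E` a number field) is realised through
`emb₀ : E →+* ℂ` as the Satake polynomials of an L-algebraic cuspidal `π` on `GL₅(𝔸_K)` at almost all
`v`, then it is so realised through every `emb : E →+* ℂ`.  Proof shape: extend `emb ∘ emb₀⁻¹` to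
`σ ∈ Aut(ℂ)` (transcendence bases; not in Mathlib); for `n = 5` odd, L-algebraic = C-algebraic
(`isCAlgebraic_iff_isLAlgebraic_of_odd`) and the unramified Hecke eigenvalues
`t_{v,i} = q_v^{i(5-i)/2} e_i(α)` carry INTEGER powers of `q_v`, so `π' := {}^σπ` (tree relation
`IsAutConjugate σ π.1 π'.1`) has Satake parameters `σ(α_v)` and Satake polynomials `σ (∏ (X - a⁻¹)) =
emb (P v)`.  Existence of `{}^σπ`, cuspidal and again L-algebraic (infinity type `{}^σT`): Clozel 1990
Thm. 3.13 when `π` is regular algebraic (tree fact `Clozel1990_regularAlgebraic`); in the IRREGULAR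
weight this route produces it is Clozel's algebraicity conjecture (Buzzard–Gee 2014 Conj. 3.1.6 /
Clozel Conj. 3.8) — why it might fail as a lemma: no rational structure on `π_f` is known for general
non-cohomological `π`; for the coherent-cohomological `π` on `U(4,1)` at hand the route is rationality
of coherent cohomology of the Picard ball quotient (Harris; Blasius–Harris–Ramakrishnan for limits of
discrete series) plus Mok/KMSW transfer to `GL₅/K`.  This is the crux's listed risk "one λ in → all emb
out" as a named lemma.  Size L.  Leans on: `CuspidalAutomorphicRepData`, `IsLAlgebraic`,
`HasSatakeParamAt`, `IsAutConjugate`, `Clozel1990_regularAlgebraic` (tree, unproved fact).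
[cite: Clozel1990, Thm. 3.13 and Conj. 3.8] [cite: BuzzardGee2014, Conj. 3.1.6 and Def. 3.1.1] -/
theorem stub_embeddingChange (E : Type) [Field E] [NumberField E]
    (P : HeightOneSpectrum (𝓞 (CyclotomicField 3 ℚ)) → Polynomial E) (emb₀ emb : E →+* ℂ)
    (hcpt : isCompact_glFiniteIntegralLevel 5 (CyclotomicField 3 ℚ))
    (h₀ : SatakeRealises P emb₀ hcpt) : SatakeRealises P emb hcpt := by
  sorry

/-! ## 3. The stub statements as named `Prop`s (literally the types of the stubs; no `sorry` inherited) -/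

namespace _Goal

/-- The statement of `stub_commutatorImageAdequate`, as a named `Prop` (literally its type). [folklore] -/
def stub_commutatorImageAdequate : Prop :=
  type_of% @Summit.Langlands.Langlands.Cruxes.PolarisedLiftingRank5.Birth.stub_commutatorImageAdequate

/-- The statement of `stub_ordinaryLiftingOneEmbedding`, as a named `Prop` (literally its type). [folklore] -/
def stub_ordinaryLiftingOneEmbedding : Prop :=
  type_of% @Summit.Langlands.Langlands.Cruxes.PolarisedLiftingRank5.Birth.stub_ordinaryLiftingOneEmbedding

/-- The statement of `stub_embeddingChange`, as a named `Prop` (literally its type). [folklore] -/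
def stub_embeddingChange : Prop :=
  type_of% @Summit.Langlands.Langlands.Cruxes.PolarisedLiftingRank5.Birth.stub_embeddingChange

end _Goal

/-! ## 4. The composition (kernel-checked, no `sorry`): IMAGE → LIFT (one embedding) → CHANGE EMBEDDING → crux by name -/

/-- **The crux from the three stubs.**  Given the crux data `(λ, j, ρ̄_K)` for `𝓢`: STUB 1 turns the
two E₆ clauses (orthogonal values, commutator-containing image) into absolute irreducibility and
adequacy of `ρ̄_K` over `𝔽̄₃`; STUB 2 (the lifting engine) then makes `𝓢` automorphic through SOME
embedding `emb₀ : E →+* ℂ`; STUB 3 moves the Satake realisation of `𝓢.charpoly` from `emb₀` to the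
given `emb`.  Hypotheses are, by name, the statements of the three stubs; the conclusion is the route
decl `PolarisedLiftingRank5`. [folklore] -/
theorem PolarisedLiftingRank5_of (h₁ : _Goal.stub_commutatorImageAdequate)
    (h₂ : _Goal.stub_ordinaryLiftingOneEmbedding) (h₃ : _Goal.stub_embeddingChange) :
    PolarisedLiftingRank5 := by
  -- read the three named statements
  have hImage : ∀ ρK : FramedGaloisRep (CyclotomicField 3 ℚ) (ZMod 3) 5,
      IsOrthogonalDetOne ρK → ContainsCommutators ρK →
        FramedRep.IsAbsolutelyIrreducible ρK ∧ HasAdequateImageFbar ρK := h₁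
  have hLift : ∀ (E : Type) [Field E] [NumberField E] (𝓢 : CompatibleSystem (CyclotomicField 3 ℚ) E 5),
      (∃ («λ» : HeightOneSpectrum (𝓞 E)) (j : ZMod 3 →+* 𝓞 E ⧸ «λ».asIdeal)
          (ρK : FramedGaloisRep (CyclotomicField 3 ℚ) (ZMod 3) 5),
        FramedRep.IsAbsolutelyIrreducible ρK ∧ HasAdequateImageFbar ρK ∧
          ResiduallyAutomorphicRegular ρK ∧ FramedRep.IsAbsolutelyIrreducible (𝓢.rep «λ») ∧
            MuOrdinaryOccultShape E 𝓢 «λ» ∧ ReducesTo E 𝓢 «λ» j ρK) →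
      Polarised E 𝓢 →
        ∃ emb₀ : E →+* ℂ, ∀ hcpt : isCompact_glFiniteIntegralLevel 5 (CyclotomicField 3 ℚ),
          SatakeRealises 𝓢.charpoly emb₀ hcpt := h₂
  have hChange : ∀ (E : Type) [Field E] [NumberField E]
      (P : HeightOneSpectrum (𝓞 (CyclotomicField 3 ℚ)) → Polynomial E) (emb₀ emb : E →+* ℂ)
      (hcpt : isCompact_glFiniteIntegralLevel 5 (CyclotomicField 3 ℚ)),
      SatakeRealises P emb₀ hcpt → SatakeRealises P emb hcpt := h₃
  -- the crux, clause by clause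
  rw [crux_iff]
  intro E _ _ 𝓢 hyp hPol emb hcpt
  obtain ⟨«λ», j, ρK, hO, hComm, hResAut, hIrr, hOrd, hRed⟩ := hyp
  -- STUB 1: the E₆ residual type has absolutely irreducible, adequate image
  obtain ⟨hAbsIrr, hAdq⟩ := hImage ρK hO hComm
  -- STUB 2: λ-adic μ-ordinary lifting — automorphy through ONE coefficient embedding `emb₀`
  obtain ⟨emb₀, hAut₀⟩ := hLift E 𝓢 ⟨«λ», j, ρK, hAbsIrr, hAdq, hResAut, hIrr, hOrd, hRed⟩ hPol
  -- STUB 3: change the coefficient embedding from `emb₀` to `emb`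
  exact hChange E 𝓢.charpoly emb₀ emb hcpt (hAut₀ hcpt)

/-- By-name sanity check (an `example`, so it is not a declaration of the file): the three stubs feed
the composition as they stand. -/
example : PolarisedLiftingRank5 :=
  PolarisedLiftingRank5_of stub_commutatorImageAdequate stub_ordinaryLiftingOneEmbedding
    stub_embeddingChange

end Summit.Langlands.Langlands.Cruxes.PolarisedLiftingRank5.Birth

end
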